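import Summits.CriticalPhenomena.PercolationContinuityZ3.Theorems.PercNearOneGluingNoHeavyLowerTailSahiMixtureTop

/-!
# MIXED one-coordinate steps: the same independent coin OR-ed into some members and AND-ed into others — the three cells over a triple
# are Bernstein-positive (two need `Cov ≥ 0` of the untouched pair, the third nothing)

Support file of the one-cut programme (crux `NoHeavyLowerTail`, stmt-CriticalPhenomena-4575; cell `prim-masterthm`, seat P3, gen 9;
`run/shared/lean/prim/prim-masterthm/prim-masterthm-p3/HIERARCHY.md` §17).  Vocabulary: `coinWeight`, `orCoin`, `andCoin`, `BernsteinPos` (`…SahiMixtureLaw`), the coin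
moments `exc_or₁/₂`, `exc_and₁/₂` (`…SahiMixtureLawCells`), defect moments (`…SahiMixtureTop`).

WHY.  The OR-mixture cells (`…SahiMixtureLawCells`, MIX(3)) and the AND-mixture theorem (`…SahiMixtureAnd`, every `n`) treat a coin entering all selected members
the SAME way.  A monotone read-once DECISION LIST reads a coordinate once but different members may use it differently ("accept if open" in one member, "reject if
closed" in another).  The one-coordinate step is then MIXED: `A ↦ A ∪ H`, `B ↦ B ∩ H`, same `H`.  Over three events there are three mixed cells up to symmetry, and all are
closed identities with nonnegative pieces (`a = 1_A`, `Ea = μ(A)`, …):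
* `sahiE_three_orAndId_eq`   (M1): `E_3(A∪H, B∩H, C) = h²·Cov(B,C) + h(1−h)·[(2 − Ea)·Cov(B,C) + Eb·μ(Ā∩C)]`;
* `sahiE_three_orAndAnd_eq`  (M2): `E_3(A∪H, B∩H, C∩H) = h³·Cov(B,C) + h²(1−h)·[(3 − Ea)Cov(B,C) + Eb·Ec] + h(1−h)²·[(2 − Ea)Cov(B,C) + (2 − Ea)·Eb·Ec]`;
* `sahiE_three_orOrAnd_eq`   (M3): `E_3(A∪H, B∪H, C∩H) = h²(1−h)·Ec·[Ea(1 − Eb) + μ(B∖A) + μ(Ā)μ(B̄)] + h(1−h)²·Ec·[Ea(1 − Eb) + μ(B∖A) + 2μ(Ā)μ(B̄)]`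
  — NO positivity hypothesis at all.
Mixed coin moments `exc_oa₂`, `exc_ao₂`, `exc_oao₃`, `exc_oaa₃`, `exc_ooa₃`; Bernstein positivity `bernsteinPos_three_orAndId/orAndAnd/orOrAnd`.  The comb-level lift and
the resulting class (triples of common-order monotone decision lists) are in `…SahiCombMixMixedThree`.  Exact pre-check of M1–M3 against brute-force enumeration:
seat folder work/mixed/dbg.py.  HONEST FRAMING: three-event cells only; nothing is claimed for four events (census running) or about Sahi's `C_k`. [this work]
-/

noncomputable section

open scoped Classical

namespace Summit.CriticalPhenomena.PercolationContinuityZ3.Theorems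

open Finset Function
open Literature.Combinatorics.Sahi2008
open Literature.Probability.Percolation.BHK2006 (ind_le_one)
open Literature.Probability.Percolation.DecisionTree (ind ind_of_mem ind_of_not_mem ind_nonneg)

namespace SahiMixture

variable {α : Type*} [Fintype α]

/-! ### Mixed coin moments -/

section Moments

variable (μ : α → ℝ) (h : ℝ)

/-- Coin moment of an OR- times an AND-mixture indicator. [this work] -/
theorem exc_oa₂ (X Y : Set α) (b b' : Bool) :
    ex (coinWeight μ h) (ind (orCoin X b) * ind (andCoin Y b')) =
      (1 - h) * ex μ (ind X * (bif b' then 0 else ind Y)) + h * ex μ ((bif b then 1 else ind X) * ind Y) := by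
  rw [ex_coinWeight]
  congr 2 <;> (congr 1; funext a; cases b <;> cases b' <;> simp)

/-- Coin moment of an AND- times an OR-mixture indicator. [this work] -/
theorem exc_ao₂ (X Y : Set α) (b b' : Bool) :
    ex (coinWeight μ h) (ind (andCoin X b) * ind (orCoin Y b')) =
      (1 - h) * ex μ ((bif b then 0 else ind X) * ind Y) + h * ex μ (ind X * (bif b' then 1 else ind Y)) := by
  rw [ex_coinWeight]
  congr 2 <;> (congr 1; funext a; cases b <;> cases b' <;> simp)

/-- Coin moment OR × AND × OR. [this work] -/
theorem exc_oao₃ (X Y Z : Set α) (b b' b'' : Bool) :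
    ex (coinWeight μ h) (ind (orCoin X b) * ind (andCoin Y b') * ind (orCoin Z b'')) =
      (1 - h) * ex μ (ind X * (bif b' then 0 else ind Y) * ind Z)
        + h * ex μ ((bif b then 1 else ind X) * ind Y * (bif b'' then 1 else ind Z)) := by
  rw [ex_coinWeight]
  congr 2 <;> (congr 1; funext a; cases b <;> cases b' <;> cases b'' <;> simp)

/-- Coin moment OR × AND × AND. [this work] -/
theorem exc_oaa₃ (X Y Z : Set α) (b b' b'' : Bool) :
    ex (coinWeight μ h) (ind (orCoin X b) * ind (andCoin Y b') * ind (andCoin Z b'')) =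
      (1 - h) * ex μ (ind X * (bif b' then 0 else ind Y) * (bif b'' then 0 else ind Z))
        + h * ex μ ((bif b then 1 else ind X) * ind Y * ind Z) := by
  rw [ex_coinWeight]
  congr 2 <;> (congr 1; funext a; cases b <;> cases b' <;> cases b'' <;> simp)

/-- Coin moment OR × OR × AND. [this work] -/
theorem exc_ooa₃ (X Y Z : Set α) (b b' b'' : Bool) :
    ex (coinWeight μ h) (ind (orCoin X b) * ind (orCoin Y b') * ind (andCoin Z b'')) =
      (1 - h) * ex μ (ind X * ind Y * (bif b'' then 0 else ind Z))
        + h * ex μ ((bif b then 1 else ind X) * (bif b' then 1 else ind Y) * ind Z) := by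
  rw [ex_coinWeight]
  congr 2 <;> (congr 1; funext a; cases b <;> cases b' <;> cases b'' <;> simp)

end Moments

/-! ### The three mixed cells over a triple -/

section Cells

variable {μ : α → ℝ} (hμ : ∀ a, 0 ≤ μ a) (hμ1 : ∑ a, μ a = 1) (A B C : Set α)
include hμ1

/-- **M1**: `E_3(A∪H, B∩H, C) = h²·Cov(B,C) + h(1−h)·[(2 − Ea)Cov(B,C) + Eb·(Ec − E[ac])]`. [this work] -/
theorem sahiE_three_orAndId_eq (h : ℝ) :
    sahiE (coinWeight μ h) 3 ![ind (orCoin A true), ind (andCoin B true), ind (orCoin C false)]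
      = h ^ 2 * (ex μ (ind B * ind C) - ex μ (ind B) * ex μ (ind C))
        + h * (1 - h) * ((2 - ex μ (ind A)) * (ex μ (ind B * ind C) - ex μ (ind B) * ex μ (ind C))
            + ex μ (ind B) * (ex μ (ind C) - ex μ (ind A * ind C))) := by
  rw [sahiE_three]
  simp only [exc_oao₃, exc_oa₂, exc_ao₂, exc_or₂, exc_or₁ μ h hμ1, exc_and₁, cond_true, cond_false, mul_one, one_mul,
    mul_zero, zero_mul, ex_zero_fun]
  ring

/-- **M2**: `E_3(A∪H, B∩H, C∩H) = h³Cov(B,C) + h²(1−h)[(3 − Ea)Cov(B,C) + Eb·Ec] + h(1−h)²[(2 − Ea)Cov(B,C) + (2 − Ea)Eb·Ec]`. [this work] -/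
theorem sahiE_three_orAndAnd_eq (h : ℝ) :
    sahiE (coinWeight μ h) 3 ![ind (orCoin A true), ind (andCoin B true), ind (andCoin C true)]
      = h ^ 3 * (ex μ (ind B * ind C) - ex μ (ind B) * ex μ (ind C))
        + h ^ 2 * (1 - h) * ((3 - ex μ (ind A)) * (ex μ (ind B * ind C) - ex μ (ind B) * ex μ (ind C)) + ex μ (ind B) * ex μ (ind C))
        + h * (1 - h) ^ 2 * ((2 - ex μ (ind A)) * (ex μ (ind B * ind C) - ex μ (ind B) * ex μ (ind C))
            + (2 - ex μ (ind A)) * (ex μ (ind B) * ex μ (ind C))) := by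
  rw [sahiE_three]
  simp only [exc_oaa₃, exc_oa₂, exc_and₂, exc_or₁ μ h hμ1, exc_and₁, cond_true, mul_one, one_mul, mul_zero, ex_zero_fun]
  ring

/-- **M3**: `E_3(A∪H, B∪H, C∩H) = h²(1−h)·Ec·[Ea + Eb − E[ab] − EaEb + (1−Ea)(1−Eb)] + h(1−h)²·Ec·[Ea + Eb − E[ab] − EaEb + 2(1−Ea)(1−Eb)]` — no hypothesis
on the law beyond total mass one. [this work] -/
theorem sahiE_three_orOrAnd_eq (h : ℝ) :
    sahiE (coinWeight μ h) 3 ![ind (orCoin A true), ind (orCoin B true), ind (andCoin C true)]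
      = h ^ 2 * (1 - h) * (ex μ (ind C) * (ex μ (ind A) + ex μ (ind B) - ex μ (ind A * ind B) - ex μ (ind A) * ex μ (ind B)
            + (1 - ex μ (ind A)) * (1 - ex μ (ind B))))
        + h * (1 - h) ^ 2 * (ex μ (ind C) * (ex μ (ind A) + ex μ (ind B) - ex μ (ind A * ind B) - ex μ (ind A) * ex μ (ind B)
            + 2 * ((1 - ex μ (ind A)) * (1 - ex μ (ind B))))) := by
  rw [sahiE_three]
  simp only [exc_ooa₃, exc_oa₂, exc_or₂, exc_or₁ μ h hμ1, exc_and₁, cond_true, mul_one, one_mul, mul_zero, ex_zero_fun, ex_one hμ1]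
  ring

include hμ

/-- **M1 is Bernstein-positive** (degree 3) given `Cov(B,C) ≥ 0`. [this work] -/
theorem bernsteinPos_three_orAndId (hBC : ex μ (ind B) * ex μ (ind C) ≤ ex μ (ind B * ind C)) :
    BernsteinPos 3 (fun h => sahiE (coinWeight μ h) 3 ![ind (orCoin A true), ind (andCoin B true), ind (orCoin C false)]) := by
  have hC : 0 ≤ ex μ (ind B * ind C) - ex μ (ind B) * ex μ (ind C) := sub_nonneg.2 hBC
  have hA : 0 ≤ 1 - ex μ (ind A) := one_sub_ex_ind_nonneg hμ hμ1 A
  have hb : 0 ≤ ex μ (ind B) := ex_nonneg hμ (ind_nonneg B)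
  have hD : 0 ≤ ex μ (ind C) - ex μ (ind A * ind C) := ex_ind_sub_ex_mul_nonneg_right hμ A C
  have hX : 0 ≤ (2 - ex μ (ind A)) * (ex μ (ind B * ind C) - ex μ (ind B) * ex μ (ind C))
      + ex μ (ind B) * (ex μ (ind C) - ex μ (ind A * ind C)) := by
    have := mul_nonneg (by linarith : (0:ℝ) ≤ 2 - ex μ (ind A)) hC
    have := mul_nonneg hb hD
    linarith
  refine (((bp_h2.smul hC).add (bp_hg.smul hX)).mono (by norm_num)).congr fun h _ _ => ?_
  rw [sahiE_three_orAndId_eq hμ1 A B C h]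
  ring

/-- **M2 is Bernstein-positive** (degree 3) given `Cov(B,C) ≥ 0`. [this work] -/
theorem bernsteinPos_three_orAndAnd (hBC : ex μ (ind B) * ex μ (ind C) ≤ ex μ (ind B * ind C)) :
    BernsteinPos 3 (fun h => sahiE (coinWeight μ h) 3 ![ind (orCoin A true), ind (andCoin B true), ind (andCoin C true)]) := by
  have hC : 0 ≤ ex μ (ind B * ind C) - ex μ (ind B) * ex μ (ind C) := sub_nonneg.2 hBC
  have hA : 0 ≤ 1 - ex μ (ind A) := one_sub_ex_ind_nonneg hμ hμ1 A
  have hb : 0 ≤ ex μ (ind B) := ex_nonneg hμ (ind_nonneg B)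
  have hc : 0 ≤ ex μ (ind C) := ex_nonneg hμ (ind_nonneg C)
  have hbc := mul_nonneg hb hc
  have hX : 0 ≤ (3 - ex μ (ind A)) * (ex μ (ind B * ind C) - ex μ (ind B) * ex μ (ind C)) + ex μ (ind B) * ex μ (ind C) := by
    have := mul_nonneg (by linarith : (0:ℝ) ≤ 3 - ex μ (ind A)) hC
    linarith
  have hY : 0 ≤ (2 - ex μ (ind A)) * (ex μ (ind B * ind C) - ex μ (ind B) * ex μ (ind C))
      + (2 - ex μ (ind A)) * (ex μ (ind B) * ex μ (ind C)) := by
    have := mul_nonneg (by linarith : (0:ℝ) ≤ 2 - ex μ (ind A)) hC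
    have := mul_nonneg (by linarith : (0:ℝ) ≤ 2 - ex μ (ind A)) hbc
    linarith
  refine (((bp_h3.smul hC).add (bp_h2g.smul hX)).add (bp_hg2.smul hY)).congr fun h _ _ => ?_
  rw [sahiE_three_orAndAnd_eq hμ1 A B C h]
  ring

/-- **M3 is Bernstein-positive** (degree 3) for EVERY probability weight. [this work] -/
theorem bernsteinPos_three_orOrAnd :
    BernsteinPos 3 (fun h => sahiE (coinWeight μ h) 3 ![ind (orCoin A true), ind (orCoin B true), ind (andCoin C true)]) := by
  have hA : 0 ≤ 1 - ex μ (ind A) := one_sub_ex_ind_nonneg hμ hμ1 A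
  have hB : 0 ≤ 1 - ex μ (ind B) := one_sub_ex_ind_nonneg hμ hμ1 B
  have ha : 0 ≤ ex μ (ind A) := ex_nonneg hμ (ind_nonneg A)
  have hc : 0 ≤ ex μ (ind C) := ex_nonneg hμ (ind_nonneg C)
  have hD : 0 ≤ ex μ (ind B) - ex μ (ind A * ind B) := ex_ind_sub_ex_mul_nonneg_right hμ A B
  have hN : 0 ≤ (1 - ex μ (ind A)) * (1 - ex μ (ind B)) := mul_nonneg (by linarith) (by linarith)
  have hU : 0 ≤ ex μ (ind A) + ex μ (ind B) - ex μ (ind A * ind B) - ex μ (ind A) * ex μ (ind B) := by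
    have := mul_nonneg ha (by linarith : (0:ℝ) ≤ 1 - ex μ (ind B))
    linarith
  have hX : 0 ≤ ex μ (ind C) * (ex μ (ind A) + ex μ (ind B) - ex μ (ind A * ind B) - ex μ (ind A) * ex μ (ind B)
      + (1 - ex μ (ind A)) * (1 - ex μ (ind B))) := mul_nonneg hc (by linarith)
  have hY : 0 ≤ ex μ (ind C) * (ex μ (ind A) + ex μ (ind B) - ex μ (ind A * ind B) - ex μ (ind A) * ex μ (ind B)
      + 2 * ((1 - ex μ (ind A)) * (1 - ex μ (ind B)))) := mul_nonneg hc (by linarith)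
  refine ((bp_h2g.smul hX).add (bp_hg2.smul hY)).congr fun h _ _ => ?_
  rw [sahiE_three_orOrAnd_eq hμ1 A B C h]
  ring

end Cells

end SahiMixture

end Summit.CriticalPhenomena.PercolationContinuityZ3.Theorems

end
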